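import Literature.Topology.FourManifolds.LatticeFormsPrimitiveEmbeddingSmallRank
import Literature.AlgebraicGeometry.Surfaces.K3MarkingProofs
import HarnessLib

/-!
# Even lattices of rank `≤ 3` embed primitively into `Λ_{K3}`; in particular every positive definite even binary
# form `((2a, b), (b, 2c))` is the Gram matrix of a primitive pair in `Λ_{K3}`
# (Huybrechts, *Lectures on K3 Surfaces*, Ch. 14 Cor. 1.9 with `(n₊, n₋) = (3, 19)`; proof of Cor. 3.10 / Thm. 3.11)

`Λ_{K3} = Matrix.toBilin' k3Gram` is even unimodular of signature `(n₊, n₋) = (3, 19)`, so Huybrechts' Cor. 1.9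
("If `m₊ + m₋ ≤ min{n₊, n₋}`, then there exists a primitive embedding `Λ₁ ↪ Λ`"; existence half, the tree's
`exists_primitiveEmbedding_of_finrank_le_sigPos_sigNeg'`) applies to every even lattice of rank `≤ 3`. For
rank `2` positive definite this is the lattice-theoretic input of the Shioda–Inose / Morrison theory of singular K3
surfaces (every positive definite even binary form is a transcendental lattice), complementing the tree's named
uniqueness fact `Nikulin1980_k3Lattice_primitiveEmbedding_rankTwo_unique` (Cor. 1.9, uniqueness half) with a
PROVED existence statement in the same concrete language. Written for lane `lit-hodgefound` (Track 2 foundations;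
prover seat `lit-hodgefound-p18`, gen 31, row g31-#12). THEOREMS ONLY — no definition, no named fact, no instance,
no notation.

## Contents (all proved)

* `sigPos_sigNeg_toBilin'_k3Gram`: `(n₊, n₋)(Λ_{K3}) = (3, 19)`.
* `exists_primitiveEmbedding_k3Lattice_of_finrank_le_three`: an even lattice `M` with `0 < rk M ≤ 3` has a
  primitive isometric embedding into `Λ_{K3}`, with orthogonal complement `≅ M(−1) ⊕ N`, `N` even unimodular of
  signature `(3 − rk M, 19 − rk M)`.
* `exists_primitive_pair_k3Gram_of_binaryForm`: for `b² ≠ 4ac` there are `t₁, t₂ ∈ Λ_{K3} = ℤ²²` with Gram matrix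
  `((2a, b), (b, 2c))` spanning a primitive sublattice (conclusion spelled exactly as in
  `Nikulin1980_k3Lattice_primitiveEmbedding_rankTwo_unique`) — for that fact's hypotheses
  `a, c > 0`, `b² < 4ac` use `hb.ne`.

## References

* [Huybrechts2016K3] D. Huybrechts, Lectures on K3 Surfaces, CUP 2016, Ch. 14 Cor. 1.9, §0.3 (vi); Ch. 14 Cor. 3.10
  (proof), §3.4.
* [Nikulin1980] V. V. Nikulin, Integral symmetric bilinear forms and some of their applications, Math. USSR Izv. 14
  (1980) 103–167, Cor. 1.12.3, Thm. 1.14.4 (cited through [Huybrechts2016K3]).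
* [AlexeevNikulin2006] V. Alexeev, V. V. Nikulin, Del Pezzo and K3 surfaces, MSJ Memoirs 15 (2006), §9.1.5 Thm. 9.5.
-/

noncomputable section

open Module Function
open LinearMap (BilinForm)
open LinearMap.BilinForm

namespace Literature.AlgebraicGeometry.Surfaces

/-- **`(n₊, n₋)(Λ_{K3}) = (3, 19)`** (`rk = 22`, `σ = −16`, Sylvester `n₊ + n₋ = rk` for the unimodular
`Λ_{K3}`). [cite: Huybrechts2016K3, Ch. 14 §0.3 (vi) ("signature `(3, 19)`")] -/
theorem sigPos_sigNeg_toBilin'_k3Gram :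
    sigPos (Matrix.toBilin' k3Gram).toQuadraticMap = 3 ∧ sigNeg (Matrix.toBilin' k3Gram).toQuadraticMap = 19 := by
  have h1 := sigPos_add_sigNeg_eq_finrank_holds (Matrix.toBilin' k3Gram) isUnimodular_toBilin'_k3Gram
    isSymm_toBilin'_k3Gram
  have h2 : (Matrix.toBilin' k3Gram).signature =
      (sigPos (Matrix.toBilin' k3Gram).toQuadraticMap : ℤ) - sigNeg (Matrix.toBilin' k3Gram).toQuadraticMap := rfl
  rw [finrank_k3Index_fun] at h1
  rw [signature_toBilin'_k3Gram] at h2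
  omega

variable {P₁ : Type*} [AddCommGroup P₁] [Module.Finite ℤ P₁] [Module.Free ℤ P₁] (B₁ : BilinForm ℤ P₁)

/-- **Every even lattice `M` with `0 < rk M ≤ 3` embeds primitively into `Λ_{K3}`**, with orthogonal complement
`≅ M(−1) ⊕ N` for an even unimodular `N` of signature `(3 − rk M, 19 − rk M)` — Huybrechts' Cor. 1.9 for
`(n₊, n₋) = (3, 19)`: "`m₊ + m₋ ≤ min{n₊, n₋}` [= 3], then there exists a primitive embedding `Λ₁ ↪ Λ`".
[cite: Huybrechts2016K3, Ch. 14 Cor. 1.9, §0.3 (vi)] [cite: Nikulin1980, Cor. 1.12.3] [cite: AlexeevNikulin2006, §9.1.5 Thm. 9.5] -/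
theorem exists_primitiveEmbedding_k3Lattice_of_finrank_le_three (h₁ : B₁.Nondegenerate) (hs₁ : B₁.IsSymm)
    (he₁ : B₁.IsEven) (h0 : 0 < finrank ℤ P₁) (h3 : finrank ℤ P₁ ≤ 3) :
    ∃ ι : P₁ →ₗ[ℤ] (K3Index → ℤ), Injective ι ∧ (∀ x y, Matrix.toBilin' k3Gram (ι x) (ι y) = B₁ x y) ∧
      (∀ (k : ℤ) (z : K3Index → ℤ), k ≠ 0 → k • z ∈ LinearMap.range ι → z ∈ LinearMap.range ι) ∧
      ∃ (W : Type) (_ : AddCommGroup W) (_ : Module.Finite ℤ W) (_ : Module.Free ℤ W) (Q : BilinForm ℤ W),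
        Q.IsSymm ∧ Q.IsUnimodular ∧ Q.IsEven ∧ sigPos Q.toQuadraticMap = 3 - finrank ℤ P₁ ∧
        sigNeg Q.toQuadraticMap = 19 - finrank ℤ P₁ ∧
        ((Matrix.toBilin' k3Gram).restrict ((Matrix.toBilin' k3Gram).orthogonal (LinearMap.range ι))).Equivalent
          ((-B₁).prod Q) := by
  obtain ⟨hp, hn⟩ := sigPos_sigNeg_toBilin'_k3Gram
  have hΛi : (Matrix.toBilin' k3Gram).IsIndefinite := isIndefinite_toBilin'_k3Gram
  have h := B₁.exists_primitiveEmbedding_of_finrank_le_sigPos_sigNeg (Matrix.toBilin' k3Gram) h₁ hs₁ he₁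
    isSymm_toBilin'_k3Gram isUnimodular_toBilin'_k3Gram isEven_toBilin'_k3Gram hΛi (by omega) (by omega)
  rw [hp, hn] at h
  exact h

/-- **Every nondegenerate even binary form `((2a, b), (b, 2c))` (`b² ≠ 4ac`; in particular every positive
definite one, `a, c > 0`, `b² < 4ac`) is the Gram matrix of a primitive pair `t₁, t₂ ∈ Λ_{K3}`** (conclusion in
the concrete language of the tree's uniqueness fact `Nikulin1980_k3Lattice_primitiveEmbedding_rankTwo_unique`):
the rank-`2` case of Cor. 1.9, `2 < 3 = min{3, 19}` — the existence input for transcendental lattices of singular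
K3 surfaces (Shioda–Inose).
[cite: Huybrechts2016K3, Ch. 14 Cor. 1.9; Ch. 14 Cor. 3.10 (proof), §3.4] [cite: Nikulin1980, Cor. 1.12.3] -/
theorem exists_primitive_pair_k3Gram_of_binaryForm (a b c : ℤ) (hdet : b * b ≠ 4 * a * c) :
    ∃ t₁ t₂ : K3Index → ℤ,
      (∑ i, ∑ j, t₁ i * k3Gram i j * t₁ j) = 2 * a ∧
      (∑ i, ∑ j, t₁ i * k3Gram i j * t₂ j) = b ∧
      (∑ i, ∑ j, t₂ i * k3Gram i j * t₂ j) = 2 * c ∧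
      ∀ (v : K3Index → ℤ) (n : ℤ), n ≠ 0 → (∃ m₁ m₂ : ℤ, n • v = m₁ • t₁ + m₂ • t₂) →
        ∃ m₁ m₂ : ℤ, v = m₁ • t₁ + m₂ • t₂ := by
  -- the binary lattice `M = (ℤ², ((2a, b), (b, 2c)))`
  let G : Matrix (Fin 2) (Fin 2) ℤ := !![2 * a, b; b, 2 * c]
  have hGs : (Matrix.toBilin' G).IsSymm :=
    Matrix.isSymm_toBilin'_iff_isSymm.mpr (Matrix.IsSymm.ext fun i j ↦ by fin_cases i <;> fin_cases j <;> rfl)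
  have hGe : (Matrix.toBilin' G).IsEven := fun x ↦ ⟨a * x 0 * x 0 + b * x 0 * x 1 + c * x 1 * x 1, by
    rw [Matrix.toBilin'_apply']
    simp [G, Matrix.mulVec, dotProduct, Fin.sum_univ_two]
    ring⟩
  have hGn : (Matrix.toBilin' G).Nondegenerate :=
    (nondegenerate_iff_det_ne_zero (Pi.basisFun ℤ (Fin 2))).2 (by
      rw [LinearMap.BilinForm.toMatrix_basisFun, LinearMap.BilinForm.toMatrix'_toBilin', Matrix.det_fin_two_of]
      intro h
      exact hdet (by linarith))
  have hr : finrank ℤ (Fin 2 → ℤ) = 2 := Module.finrank_fin_fun ℤ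
  obtain ⟨hp, hn⟩ := sigPos_sigNeg_toBilin'_k3Gram
  obtain ⟨ι, hι, hιB, hprim⟩ := (Matrix.toBilin' G).exists_primitiveEmbedding_of_finrank_le_sigPos_sigNeg'
    (Matrix.toBilin' k3Gram) hGn hGs hGe isSymm_toBilin'_k3Gram isUnimodular_toBilin'_k3Gram isEven_toBilin'_k3Gram
    (by rw [hr]; norm_num) (by rw [hr, hp]; norm_num) (by rw [hr, hn]; norm_num)
  have hgram : ∀ i j : Fin 2, Matrix.toBilin' k3Gram (ι (Pi.single i 1)) (ι (Pi.single j 1)) = G i j := fun i j ↦ by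
    rw [hιB, Matrix.toBilin'_single]
  have hvec : ∀ w : Fin 2 → ℤ, w = w 0 • Pi.single 0 1 + w 1 • Pi.single 1 1 := fun w ↦ by
    ext i; fin_cases i <;> simp
  have hsum : ∀ x y : K3Index → ℤ, (∑ i, ∑ j, x i * k3Gram i j * y j) = Matrix.toBilin' k3Gram x y :=
    fun x y ↦ (Matrix.toBilin'_apply k3Gram x y).symm
  refine ⟨ι (Pi.single 0 1), ι (Pi.single 1 1), ?_, ?_, ?_, fun v n hn0 ⟨m₁, m₂, hv⟩ ↦ ?_⟩
  · rw [hsum, hgram]; simp [G]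
  · rw [hsum, hgram]; simp [G]
  · rw [hsum, hgram]; simp [G]
  · have hmem : n • v ∈ LinearMap.range ι :=
      ⟨m₁ • Pi.single 0 1 + m₂ • Pi.single 1 1, by rw [map_add, map_smul, map_smul, hv]⟩
    obtain ⟨w, hw⟩ := hprim n v hn0 hmem
    have hw' : ι w = w 0 • ι (Pi.single 0 1) + w 1 • ι (Pi.single 1 1) := by
      conv_lhs => rw [hvec w]
      rw [map_add, map_smul, map_smul]
    exact ⟨w 0, w 1, by rw [← hw, hw']⟩

end Literature.AlgebraicGeometry.Surfaces
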